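import Mathlib.RingTheory.Derivation.Basic
import Summits.ResolutionOfSingularities.ResolutionOfSingularities.Theorems.ValuativeLuAlphaPTorsorDiscreteRounds

/-!
# The initial derivation along a discrete rank-one valuation, all base dimensions

Helper file for the line `pfaff-line-log-final-forms` of the crux `Valuative.LuAlphaPTorsor`
(item `stmt-ResolutionOfSingularities-0641`), branch `DiscreteAllDim` (the crux along every
discrete rank-one valuation, every base dimension), layer L2 (registered helper stub
`discreteAllDim_initialDerivation`). It is the dimension-free version of the two-dimensional
`discreteSequence_initialDerivation`
(`Theorems/ValuativeLuAlphaPTorsorDiscreteInitialDerivation.lean`).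

Setting, abstracted to one stage `S` of the quadratic sequence: `S` is a subring of the field
`K'` dominated by the valuation ring `O'`; `π = u 0` has the LARGEST value `< 1`;
`u : Fin (d + 2) → K'` are non-units of `S` with dual derivations `Du l` of `K'` preserving `S`
(`Du l (u j) = δ_{lj}`); and `D` is ANY derivation of `K'` preserving `S` with `D a ≠ 0`.
PROVED (`discreteAllDim_initialDerivation`): there are `π' ∈ S` of the same value as `π` and a
derivation `D₀` of `K'` preserving `S` with `D₀ π' = 0` and `D₀ a ≠ 0`. Three cases:

* some `j ≠ 0` has `Du j a ≠ 0`: `π' := π`, `D₀ := Du j`;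
* `Du j a = 0` for all `j ≠ 0` but `Du 0 a ≠ 0`: `π' := π + (u 1) ^ M`,
  `D₀ := Du 1 - (M (u 1)^{M-1}) • Du 0` (`M ≥ 2`, `M ≠ 0` in `K'`): `D₀ π' = 0`,
  `D₀ a = -M (u 1)^{M-1} Du 0 a ≠ 0`, and `v((u 1)^M) ≤ v(π)^M < v(π)` so `v(π') = v(π)`;
* `Du j a = 0` for all `j`: `π' := π`, `D₀ := D - ∑ j, (D (u j)) • Du j`, which kills every
  `u j` and agrees with `D` on `a`.

All [folklore] (elementary calculus of derivations on a regular local ring with a regular system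
of parameters; Zariski; Abhyankar 1956, §2).
-/

set_option linter.dupNamespace false

namespace Summit.ResolutionOfSingularities.ResolutionOfSingularities.Theorems.PfaffLine

open Literature.AlgebraicGeometry.Resolution

namespace DiscreteAllDim

/-- Evaluating a finite sum of derivations of a field at an element. [folklore] -/
theorem derivation_sum_apply {K : Type} [Field K] {ι : Type} (s : Finset ι)
    (f : ι → Derivation ℤ K K) (z : K) : (s.sum f) z = s.sum fun j => f j z := by
  induction s using Finset.cons_induction with
  | empty => rw [Finset.sum_empty, Finset.sum_empty, Derivation.zero_apply]
  | cons i s hi ih => rw [Finset.sum_cons, Finset.sum_cons, Derivation.add_apply, ih]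

end DiscreteAllDim

open DiscreteAllDim in
/-- **Initial derivation, all base dimensions** (layer L2 of the branch `DiscreteAllDim` of the
line `pfaff-line-log-final-forms`). At a stage `S` dominated by `O'`, with `π = u 0` of largest
value `< 1`, non-units `u : Fin (d + 2) → K'` of `S` with dual derivations `Du l` of `K'`
preserving `S`, and a derivation `D` of `K'` preserving `S` with `D a ≠ 0`: there are `π' ∈ S`
of the same value as `π` and a derivation `D₀` of `K'` preserving `S` with `D₀ π' = 0` and
`D₀ a ≠ 0`. [folklore] -/
theorem discreteAllDim_initialDerivation :
    ∀ (K' : Type) [Field K'] (O' : ValuationSubring K') (S : Subring K') (π a : K') (d M : ℕ) (u : Fin (d + 2) → K') (Du : Fin (d + 2) → Derivation ℤ K' K') (D : Derivation ℤ K' K'), Literature.AlgebraicGeometry.Resolution.SubringDominates S O'.toSubring → O'.valuation π < 1 → (∀ z : K', O'.valuation z < 1 → O'.valuation z ≤ O'.valuation π) → u 0 = π → (∀ j, u j ∈ S ∧ O'.valuation (u j) < 1) → (∀ l j, Du l (u j) = if l = j then 1 else 0) → (∀ l, ∀ z : K', z ∈ S → Du l z ∈ S) → (∀ z : K', z ∈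 S → D z ∈ S) → a ∈ S → D a ≠ 0 → 2 ≤ M → (M : K') ≠ 0 → ∃ (π' : K') (D₀ : Derivation ℤ K' K'), π' ∈ S ∧ O'.valuation π' = O'.valuation π ∧ D₀ π' = 0 ∧ (∀ z : K', z ∈ S → D₀ z ∈ S) ∧ D₀ a ≠ 0 := by
  intro K' _ O' S π a d M u Du D _hdom hπ1 hmax hu0 huS hdual hDuS hDS _haS hDa hM hMK
  have hπS : π ∈ S := hu0 ▸ (huS 0).1
  by_cases h1 : ∃ j, j ≠ 0 ∧ Du j a ≠ 0
  · -- Case 1: some `j ≠ 0` has `Du j a ≠ 0`; `π' := π`, `D₀ := Du j`.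
    obtain ⟨j, hj0, hja⟩ := h1
    refine ⟨π, Du j, hπS, rfl, ?_, hDuS j, hja⟩
    rw [← hu0, hdual j 0, if_neg hj0]
  push Not at h1
  have h10 : (1 : Fin (d + 2)) ≠ 0 := Fin.zero_ne_one.symm
  -- the dual relations at the indices `0` and `1`
  have hD0π : Du 0 π = 1 := by rw [← hu0, hdual 0 0, if_pos rfl]
  have hD1π : Du 1 π = 0 := by rw [← hu0, hdual 1 0, if_neg h10]
  have hD11 : Du 1 (u 1) = 1 := by rw [hdual 1 1, if_pos rfl]
  have hD01 : Du 0 (u 1) = 0 := by rw [hdual 0 1, if_neg h10.symm]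
  rcases ne_or_eq (Du 0 a) 0 with h0 | h0
  · -- Case 2: `Du j a = 0` for `j ≠ 0` but `Du 0 a ≠ 0`;
    -- `π' := π + (u 1) ^ M`, `D₀ := Du 1 - (M (u 1)^{M-1}) • Du 0`.
    obtain ⟨m, rfl⟩ : ∃ m, M = m + 1 := ⟨M - 1, by omega⟩
    have hy0 : u 1 ≠ 0 := by
      intro h
      rw [h, map_zero] at hD11
      exact zero_ne_one hD11
    have hπ0 : π ≠ 0 := by
      intro h
      rw [h, map_zero] at hD0π
      exact zero_ne_one hD0π
    have hvπ0 : 0 < O'.valuation π := (Valuation.pos_iff _).mpr hπ0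
    have hvyM : O'.valuation (u 1 ^ (m + 1)) < O'.valuation π := by
      rw [map_pow]
      calc O'.valuation (u 1) ^ (m + 1) ≤ O'.valuation π ^ (m + 1) :=
            pow_le_pow_left₀ zero_le (hmax (u 1) (huS 1).2) _
        _ < O'.valuation π := pow_lt_self_of_lt_one₀ hvπ0 hπ1 (by omega)
    refine ⟨π + u 1 ^ (m + 1), Du 1 - (((m + 1 : ℕ) : K') * u 1 ^ m) • Du 0,
      S.add_mem hπS (S.pow_mem (huS 1).1 _), ?_, ?_, ?_, ?_⟩
    · -- value
      exact Valuation.map_add_eq_of_lt_left _ hvyM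
    · -- `D₀ π' = 0`
      rw [Derivation.sub_apply, Derivation.smul_apply, smul_eq_mul, map_add, map_add,
        Derivation.leibniz_pow, Derivation.leibniz_pow, hD0π, hD1π, hD11, hD01]
      simp only [Nat.add_sub_cancel, smul_eq_mul, nsmul_eq_mul, mul_zero, mul_one, add_zero,
        zero_add]
      ring
    · -- `D₀` preserves `S`
      intro z hz
      rw [Derivation.sub_apply, Derivation.smul_apply, smul_eq_mul]
      exact S.sub_mem (hDuS 1 z hz)
        (S.mul_mem (S.mul_mem (natCast_mem S _) (S.pow_mem (huS 1).1 _)) (hDuS 0 z hz))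
    · -- `D₀ a ≠ 0`
      rw [Derivation.sub_apply, Derivation.smul_apply, smul_eq_mul, h1 1 h10, zero_sub,
        neg_ne_zero]
      exact mul_ne_zero (mul_ne_zero hMK (pow_ne_zero _ hy0)) h0
  · -- Case 3: `Du j a = 0` for all `j`; `π' := π`, `D₀ := D - ∑ j, (D (u j)) • Du j`.
    have hall : ∀ j, Du j a = 0 := by
      intro j
      rcases eq_or_ne j 0 with rfl | hj
      · exact h0
      · exact h1 j hj
    refine ⟨π, D - Finset.univ.sum fun j => (D (u j)) • Du j, hπS, rfl, ?_, ?_, ?_⟩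
    · -- `D₀ π = D π - ∑ j, D (u j) * δ_{j0} = 0`
      rw [Derivation.sub_apply, derivation_sum_apply, ← hu0]
      simp_rw [Derivation.smul_apply, smul_eq_mul, hdual, mul_ite, mul_one, mul_zero]
      rw [Finset.sum_ite_eq' Finset.univ (0 : Fin (d + 2)) (fun j => D (u j)),
        if_pos (Finset.mem_univ _), sub_self]
    · -- `D₀` preserves `S`
      intro z hz
      rw [Derivation.sub_apply, derivation_sum_apply]
      refine S.sub_mem (hDS z hz) (sum_mem fun j _ => ?_)
      rw [Derivation.smul_apply, smul_eq_mul]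
      exact S.mul_mem (hDS _ (huS j).1) (hDuS j z hz)
    · -- `D₀ a = D a ≠ 0`
      rw [Derivation.sub_apply, derivation_sum_apply]
      simp_rw [Derivation.smul_apply, smul_eq_mul, hall, mul_zero, Finset.sum_const_zero,
        sub_zero]
      exact hDa

end Summit.ResolutionOfSingularities.ResolutionOfSingularities.Theorems.PfaffLine
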